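import Summits.CriticalPhenomena.CardyFormulaZ2.Theorems.CardyBoundaryCoulombGasBoundaryDefectGaussianRStubClusterLocalityV2Part10
import Summits.CriticalPhenomena.CardyFormulaZ2.Theorems.HalfPlaneOneArmThird.Negative.Basics
import Literature.Probability.Percolation.HalfPlaneArmAxisInputs
import Literature.Probability.Percolation.LatticeSymmetry
import Literature.Probability.Percolation.InequalitiesProofs
import HarnessLib

/-!
# Hardness certificate of crux `BoundaryDefectGaussianR` (stmt-CriticalPhenomena-14132), line
# `rainbow-monomials-in-excursion-kernels` — Stub H4: the gluing lower bound
# `c · θ(12(n+1))² ≤ P_{1/2}[(-4(n+1), -12(n+1)) ↔ (4(n+1), -12(n+1)) in [-12(n+1), 12(n+1)]²]`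

Critical bond percolation on `ℤ²` (`bondPercolation (zdGraph 2) half`); `θ(m) = prob half m` is the
half-plane one-arm probability of crux 6 (`HalfPlaneOneArmThird`), the probability that `0` is
joined inside the half-box `[-m, m] × [0, m]` to its outer boundary. With `k = 2(n+1)`:

1. TRANSLATION (`real_openCrossing_shift`): the connection probability of the two bottom-row points
   of the square `[-12(n+1), 12(n+1)]²` equals that of `u' = (-2k, 0)`, `w' = (2k, 0)` inside the
   translated square `[-6k, 6k] × [0, 12k]`, which contains the half-box `hbox[4k]`
   (`openConnIn_mono`);
2. GLUING (`real_twoArm_le_conn`, the landed step (A) of `stub_clusterLocalityV2`, Part 10):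
   `c · P[Arm[u', 4k] ∩ Arm[w', 4k]] ≤ P[u' ↔ w' in hbox[4k]]` for `k ≥ k₀`;
3. HARRIS–FKG (`harris_fkg_holds`): `P[Arm[u', 4k]] · P[Arm[w', 4k]] ≤ P[Arm[u', 4k] ∩ Arm[w', 4k]]`;
4. FIRST EXIT (`exists_openConnIn_le_level`): the translate by `u'` of the arm event of `θ(6k)`
   (an open path from `u'` inside `u' + [-6k, 6k] × [0, 6k]` to its outer boundary) reaches
   half-plane norm `≥ 4k`, so its piece up to the first visit of the level `4k` is an arm
   `Arm[u', 4k]`; with translation invariance, `θ(6k) ≤ P[Arm[u', 4k]]`, and the same for `w'`.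
-/

noncomputable section

namespace Summit.CriticalPhenomena.CardyFormulaZ2.Cruxes.BoundaryDefectGaussianR.RainbowMonomialsInExcursionKernels

open MeasureTheory Set Literature.Probability.Percolation Literature.Probability.LatticeModels

local notation3 "hbox[" n "]" => {v : Site 2 | 0 ≤ v 1 ∧ max |v 0| (v 1) ≤ n}
local notation3 "lvl[" n "]" => {v : Site 2 | max |v 0| (v 1) = n}
local notation3 "Arm[" u ", " n "]" => openCrossing hbox[n] {u} lvl[n]
local notation3 "sArm[" b ", " m "]" =>
  openCrossing {v : Site 2 | 0 ≤ v 1 ∧ max |v 0 - b 0| (v 1 - b 1) ≤ m} {b}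
    {v : Site 2 | max |v 0 - b 0| (v 1 - b 1) = m}
local notation3 "μ" => bondPercolation (zdGraph 2) half

/-! ### Translation invariance -/

/-- `{x ↔ y in S}` is the open crossing event between the singletons `{x}`, `{y}`. [folklore] -/
theorem aslc_openCrossing_singleton (S : Set (Site 2)) (x y : Site 2) :
    openCrossing S {x} {y} = openConnIn S x y := by
  ext ω
  simp only [mem_openCrossing_iff, mem_singleton_iff, exists_eq_left]

/-- **Translation of a restricted connection into a larger region**: if `S + t ⊆ T` then
`P[x ↔ y in S] ≤ P[x + t ↔ y + t in T]` (`real_openCrossing_shift`, `openConnIn_mono`).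
[folklore] -/
theorem aslc_real_openConnIn_shift_le {S T : Set (Site 2)} {x y x' y' : Site 2} (t : Site 2)
    (hST : ∀ v ∈ S, v + t ∈ T) (hx : x + t = x') (hy : y + t = y') :
    (μ).real (openConnIn S x y) ≤ (μ).real (openConnIn T x' y') := by
  rw [← aslc_openCrossing_singleton, ← aslc_openCrossing_singleton,
    ← real_openCrossing_shift half t S {x} {y}, image_singleton, image_singleton, hx, hy]
  refine measureReal_mono (openCrossing_mono ?_ subset_rfl subset_rfl) (measure_ne_top _ _)
  rintro _ ⟨v, hv, rfl⟩
  exact hST v hv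

/-- **Translation of the one-arm event** (adapted from `real_arm_shift_le_N5` of the line
`qkz-strip-boundary-arm`): the crux-6 probability `θ(m)` is at most (in fact equal to) the
probability of the arm event based at any point `b` of the axis `{b₁ = 0}` — an open path from `b`
inside `[b₀ - m, b₀ + m] × [0, m]` to the outer boundary of this half-box (`HalfPlaneArm.axisArm_eq`,
`real_openCrossing_shift`). [folklore] -/
theorem aslc_prob_le_shiftedArm {b : Site 2} (hb : b 1 = 0) (m : ℕ) :
    Summit.CriticalPhenomena.CardyFormulaZ2.Theorems.HalfPlaneOneArmThird.Negative.prob half m ≤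
      (μ).real sArm[b, (m : ℤ)] := by
  simp only [Summit.CriticalPhenomena.CardyFormulaZ2.Theorems.HalfPlaneOneArmThird.Negative.prob,
    Summit.CriticalPhenomena.CardyFormulaZ2.Theorems.HalfPlaneOneArmThird.Negative.armEvt,
    Summit.CriticalPhenomena.CardyFormulaZ2.Theorems.HalfPlaneOneArmThird.Negative.halfBox]
  rw [HalfPlaneArm.axisArm_eq, ← real_openCrossing_shift half b]
  refine measureReal_mono (openCrossing_mono ?_ ?_ ?_) (measure_ne_top _ _)
  · rintro _ ⟨v, hv, rfl⟩
    obtain ⟨h0, hm⟩ := hv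
    rw [max_le_iff, abs_le] at hm
    simp only [Pi.zero_apply, sub_zero] at hm
    simp only [mem_setOf_eq, Pi.add_apply, add_sub_cancel_right, max_le_iff, abs_le]
    omega
  · rintro _ ⟨v, hv, rfl⟩
    rw [mem_singleton_iff] at hv ⊢
    rw [hv]
    exact zero_add b
  · rintro _ ⟨v, hv, rfl⟩
    have hv : max |v 0 - (0 : Site 2) 0| (v 1 - (0 : Site 2) 1) = m := hv
    simp only [Pi.zero_apply, sub_zero] at hv
    show max |(v + b) 0 - b 0| ((v + b) 1 - b 1) = m
    simpa only [Pi.add_apply, add_sub_cancel_right] using hv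

/-! ### First exit: a far arm about an axis point contains an arm to a level of the centred half-box -/

/-- **First exit.** On a lattice configuration, an open path from an axis point `b` (`b₁ = 0`,
`|b₀| ≤ N`) inside `[b₀ - m, b₀ + m] × [0, m]` to the outer boundary of this half-box, with
`N + |b₀| ≤ m`, ends at half-plane norm `max |y₀| y₁ ≥ N`; its initial piece up to the first
visit of the level `{max |v₀| v₁ = N}` of the `1`-Lipschitz half-plane norm
(`exists_openConnIn_le_level`, `hnorm_le_of_adj`) is an arm `Arm[b, N]` inside `hbox[N]`.
[folklore] -/
theorem aslc_arm_of_shiftedArm {ω : BondConfig (Site 2)} (hω : ω ⊆ (zdGraph 2).edgeSet)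
    {b : Site 2} {m N : ℤ} (hb : b 1 = 0) (hbN : -N ≤ b 0) (hbN' : b 0 ≤ N) (hm : N + b 0 ≤ m)
    (hm' : N - b 0 ≤ m) (h : ω ∈ sArm[b, m]) : ω ∈ Arm[b, N] := by
  obtain ⟨x, hx, y, hy, hxy⟩ := h
  rw [mem_singleton_iff] at hx
  subst hx
  have hy : max |y 0 - x 0| (y 1 - x 1) = m := hy
  have hxN : max |x 0| (x 1) ≤ N := by
    rw [max_le_iff, abs_le, hb]
    omega
  have hyN : N ≤ max |y 0| (y 1) := by
    rcases le_total |y 0 - x 0| (y 1 - x 1) with hle | hle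
    · rw [max_eq_right hle] at hy
      rw [hb] at hy
      exact le_max_of_le_right (by omega)
    · rw [max_eq_left hle] at hy
      refine le_max_of_le_left ?_
      rcases (abs_eq (show (0 : ℤ) ≤ m by have := abs_nonneg (y 0 - x 0); omega)).1 hy with
        h1 | h1
      · have : y 0 ≤ |y 0| := le_abs_self _
        omega
      · have : -(y 0) ≤ |y 0| := neg_le_abs _
        omega
  obtain ⟨z, hz, hconn⟩ := exists_openConnIn_le_level hω (fun v : Site 2 => max |v 0| (v 1))
    hnorm_le_of_adj N hxN hyN hxy
  refine ⟨x, mem_singleton _, z, hz, openConnIn_mono ?_ _ _ hconn⟩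
  exact fun v hv => ⟨hv.1.1, hv.2⟩

/-- `P[sArm[b, m]] ≤ P[Arm[b, N]]` under the hypotheses of `aslc_arm_of_shiftedArm` (the
inclusion holds almost surely, `ae_subset_edgeSet`). [folklore] -/
theorem aslc_real_shiftedArm_le_arm {b : Site 2} {m N : ℤ} (hb : b 1 = 0) (hbN : -N ≤ b 0)
    (hbN' : b 0 ≤ N) (hm : N + b 0 ≤ m) (hm' : N - b 0 ≤ m) :
    (μ).real sArm[b, m] ≤ (μ).real Arm[b, N] := by
  refine ENNReal.toReal_mono (measure_ne_top _ _) (measure_mono_ae ?_)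
  filter_upwards [ae_subset_edgeSet (zdGraph 2) half] with ω hω h
  exact aslc_arm_of_shiftedArm hω hb hbN hbN' hm hm' h

/-- **The arm of `θ(12(n+1))` about an axis point `b` with `|b₀| = 4(n+1)` contains an arm to the
level `8(n+1)` of the centred half-box**: `θ(12(n+1)) ≤ P[Arm[b, 8(n+1)]]`. [folklore] -/
theorem aslc_prob_le_arm (n : ℕ) {b : Site 2} (hb : b 1 = 0) (hb0 : b 0 = 4 * ((n : ℤ) + 1) ∨
    b 0 = -(4 * ((n : ℤ) + 1))) :
    Summit.CriticalPhenomena.CardyFormulaZ2.Theorems.HalfPlaneOneArmThird.Negative.prob half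
        (12 * (n + 1)) ≤ (μ).real Arm[b, 8 * ((n : ℤ) + 1)] := by
  refine (aslc_prob_le_shiftedArm hb (12 * (n + 1))).trans
    (aslc_real_shiftedArm_le_arm hb ?_ ?_ ?_ ?_) <;> push_cast <;> omega

/-! ### The registered stub H4 -/

/-- **Stub H4.** `c · θ(12(n+1))² ≤ P_{1/2}[(-4(n+1),-12(n+1)) ↔ (4(n+1),-12(n+1)) in V_n]` for large `n`:
translate the bottom row to height `0`; the arms of radius `12(n+1)` about the two points contain arms to the
level of the half-box `hbox[8(n+1)]` (first exit), which a U of box crossings glues (`real_twoArm_le_conn`),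
Harris–FKG. [folklore] -/
theorem h19_armSq_le_conn : ∃ c : ℝ, 0 < c ∧ ∃ N₀ : ℕ, ∀ n : ℕ, N₀ ≤ n →
    c * (Summit.CriticalPhenomena.CardyFormulaZ2.Theorems.HalfPlaneOneArmThird.Negative.prob
          Literature.Probability.Percolation.half (12 * (n + 1))) ^ 2 ≤
      (Literature.Probability.Percolation.bondPercolation (Literature.Probability.LatticeModels.zdGraph 2)
          Literature.Probability.Percolation.half).real
        (Literature.Probability.Percolation.openConnIn
          {v : Literature.Probability.LatticeModels.Site 2 |
            (-(12 * ((n : ℤ) + 1)) ≤ v 0 ∧ v 0 ≤ 12 * ((n : ℤ) + 1)) ∧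
              (-(12 * ((n : ℤ) + 1)) ≤ v 1 ∧ v 1 ≤ 12 * ((n : ℤ) + 1))}
          (![-(4 * ((n : ℤ) + 1)), -(12 * ((n : ℤ) + 1))] : Literature.Probability.LatticeModels.Site 2)
          (![4 * ((n : ℤ) + 1), -(12 * ((n : ℤ) + 1))] : Literature.Probability.LatticeModels.Site 2)) := by
  obtain ⟨c, hc, k₀, hA⟩ := real_twoArm_le_conn
  refine ⟨c, hc, k₀, fun n hn => ?_⟩
  set θ : ℝ := Summit.CriticalPhenomena.CardyFormulaZ2.Theorems.HalfPlaneOneArmThird.Negative.prob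
    half (12 * (n + 1)) with hθ
  -- the two translated points on the axis
  set u' : Site 2 := ![-(4 * ((n : ℤ) + 1)), 0] with hu'
  set w' : Site 2 := ![4 * ((n : ℤ) + 1), 0] with hw'
  have hu0 : u' 0 = -(4 * ((n : ℤ) + 1)) := by simp [hu']
  have hu1 : u' 1 = 0 := by simp [hu']
  have hw0 : w' 0 = 4 * ((n : ℤ) + 1) := by simp [hw']
  have hw1 : w' 1 = 0 := by simp [hw']
  -- (2) gluing at the scale `k = 2(n+1)`
  have hk : k₀ ≤ 2 * (n + 1) := by omega
  have hAk := hA (2 * (n + 1)) hk u' w'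
    (by rw [hu0, hu1, max_le_iff, abs_le]; push_cast; omega)
    (by rw [hw0, hw1, max_le_iff, abs_le]; push_cast; omega)
  have e4 : (4 : ℤ) * ((2 * (n + 1) : ℕ) : ℤ) = 8 * ((n : ℤ) + 1) := by push_cast; ring
  rw [e4] at hAk
  -- (4) the two arms
  have hθu : θ ≤ (μ).real Arm[u', 8 * ((n : ℤ) + 1)] := aslc_prob_le_arm n hu1 (Or.inr hu0)
  have hθw : θ ≤ (μ).real Arm[w', 8 * ((n : ℤ) + 1)] := aslc_prob_le_arm n hw1 (Or.inl hw0)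
  -- (3) Harris–FKG
  have hH : (μ).real Arm[u', 8 * ((n : ℤ) + 1)] * (μ).real Arm[w', 8 * ((n : ℤ) + 1)] ≤
      (μ).real (Arm[u', 8 * ((n : ℤ) + 1)] ∩ Arm[w', 8 * ((n : ℤ) + 1)]) :=
    harris_fkg_holds (zdGraph 2) half (isUpperSet_openCrossing _ _ _) (isUpperSet_openCrossing _ _ _)
      (HalfPlaneArm.measurableSet_openCrossing_of_finite (hbox_finite _) _ _)
      (HalfPlaneArm.measurableSet_openCrossing_of_finite (hbox_finite _) _ _)
  -- (1) translation of the connection down to the bottom row of the square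
  have hS : (μ).real (openConnIn hbox[8 * ((n : ℤ) + 1)] u' w') ≤
      (μ).real (openConnIn
        {v : Site 2 | (-(12 * ((n : ℤ) + 1)) ≤ v 0 ∧ v 0 ≤ 12 * ((n : ℤ) + 1)) ∧
          (-(12 * ((n : ℤ) + 1)) ≤ v 1 ∧ v 1 ≤ 12 * ((n : ℤ) + 1))}
        (![-(4 * ((n : ℤ) + 1)), -(12 * ((n : ℤ) + 1))] : Site 2)
        (![4 * ((n : ℤ) + 1), -(12 * ((n : ℤ) + 1))] : Site 2)) := by
    refine aslc_real_openConnIn_shift_le (![0, -(12 * ((n : ℤ) + 1))] : Site 2) ?_ ?_ ?_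
    · rintro v ⟨h0, hv⟩
      rw [max_le_iff, abs_le] at hv
      simp only [mem_setOf_eq, Pi.add_apply, Matrix.cons_val_zero, Matrix.cons_val_one,
        Matrix.cons_val_fin_one]
      omega
    · ext i
      fin_cases i <;> simp [hu']
    · ext i
      fin_cases i <;> simp [hw']
  -- assembly
  have hθ0 : 0 ≤ θ :=
    Summit.CriticalPhenomena.CardyFormulaZ2.Theorems.HalfPlaneOneArmThird.Negative.prob_nonneg _ _
  calc c * θ ^ 2 = c * (θ * θ) := by ring
    _ ≤ c * ((μ).real Arm[u', 8 * ((n : ℤ) + 1)] * (μ).real Arm[w', 8 * ((n : ℤ) + 1)]) :=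
        mul_le_mul_of_nonneg_left (mul_le_mul hθu hθw hθ0 measureReal_nonneg) hc.le
    _ ≤ c * (μ).real (Arm[u', 8 * ((n : ℤ) + 1)] ∩ Arm[w', 8 * ((n : ℤ) + 1)]) :=
        mul_le_mul_of_nonneg_left hH hc.le
    _ ≤ (μ).real (openConnIn hbox[8 * ((n : ℤ) + 1)] u' w') := hAk
    _ ≤ _ := hS

end Summit.CriticalPhenomena.CardyFormulaZ2.Cruxes.BoundaryDefectGaussianR.RainbowMonomialsInExcursionKernels

end
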